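import Summits.ResolutionOfSingularities.ResolutionOfSingularities.Theorems.RadicialJungCleanModelsF75cGoodSnc
import Literature.AlgebraicGeometry.Resolution.AlterationsMultisectionLocalStepProofs
import Literature.AlgebraicGeometry.Resolution.ExceptionalPointsFinite
import Literature.AlgebraicGeometry.Resolution.BlowupChartMembership
import HarnessLib

/-!
# [F-75c discharge, brick A1] The support of an effective Cartier divisor on a regular surface is a finite union of
# members (curves) and isolated closed points with one-dimensional local rings; Cartier divisors and non-zero ideal
# sheaves pull back along compositions of point blow-ups (The Stacks Project, Lemma 54.15.6 = Tag 0BIC, proof ¶1–¶2)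

Cell res-hironaka, D-0154 INPUTS discharger `res-inputs-p-f75c` for the named fact F-75c
`Literature.AlgebraicGeometry.Resolution.Stacks0BIC_embeddedResolutionCurvesInSurfaces_locus`
(`--supports stmt-ResolutionOfSingularities-15917 --as helper`). After the Cartier step (brick P3) the inverse image
`Z₁` of `Z` is an effective Cartier divisor; its «irreducible components `Y_i`» (Tag 0BIC ¶2) are the closures of the
points `ζ ∈ V(Z₁)` with `dim 𝒪_{ζ} = 1` (Krull's Hauptidealsatz: every point of `V(Z₁)` specialises from such a `ζ`);
those `ζ` which are NOT closed points give the members of the initial configuration, the closed ones are isolated points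
of `V(Z₁)` with a discrete valuation ring.

* `ringKrullDim_stalk_ne_zero_of_mem_support` — a point of the support of an effective Cartier divisor on a scheme with
  regular (reduced) local rings is not a maximal point of the scheme;
* **`exists_members_decomposition`** — `V(D) = ⋃ 𝒞₀ ∪ P` with `𝒞₀` a finite set of members and `P` a finite set of
  closed points with one-dimensional local rings lying on no member;
* `IsPointBlowupComposition.isEffectiveCartier_comap`, `IsPointBlowupComposition.comap_ne_bot` — pull-backs along
  compositions of point blow-ups (tree: `IsEffectiveCartier.comap_of_isBlowup`, `IsBlowup.comap_ne_bot`).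

HONEST FRAMING: bookkeeping over tree theorems; nothing here is a statement of [Hironaka2017]. AI-written; AI review is
weaker than expert review. References: The Stacks Project, Tags 0BIC, 00KV [StacksProject].
-/

noncomputable section

set_option linter.dupNamespace false -- mandated namespace of this single-conjunct summit

open CategoryTheory AlgebraicGeometry TopologicalSpace IsLocalRing

namespace Summit.ResolutionOfSingularities.ResolutionOfSingularities.Theorems

namespace F75c

open Literature.AlgebraicGeometry.Resolution
open Scheme.IdealSheafData

universe u

/-! ## Pull-backs along compositions of point blow-ups -/

section Pullback

variable {X : Scheme.{u}} {T : Set X}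

/-- **Effective Cartier divisors pull back to effective Cartier divisors along compositions of point blow-ups.**
[cite: StacksProject, Tag 0BIC (Lemma 54.15.6, proof ¶1)] [cite: StacksProject, Tag 02OS] -/
theorem IsPointBlowupComposition.isEffectiveCartier_comap :
    ∀ {X' : Scheme.{u}} {π : X' ⟶ X}, IsPointBlowupComposition T π →
      ∀ {D : X.IdealSheafData}, IsEffectiveCartier D → IsEffectiveCartier (D.comap π) := by
  intro X' π h
  induction h with
  | nil => intro D hD; rwa [Scheme.IdealSheafData.comap_id]
  | cons τ σ x' hx' hσ hne hT hτ ih =>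
    intro D hD
    rw [Scheme.IdealSheafData.comap_comp]
    exact (ih hD).comap_of_isBlowup hτ

/-- **Non-zero ideal sheaves pull back to non-zero ideal sheaves along compositions of point blow-ups of an integral
scheme.** [cite: StacksProject, Tag 02OS] -/
theorem IsPointBlowupComposition.comap_ne_bot [IsIntegral X] :
    ∀ {X' : Scheme.{u}} {π : X' ⟶ X}, IsPointBlowupComposition T π →
      ∀ {D : X.IdealSheafData}, D ≠ ⊥ → D.comap π ≠ ⊥ := by
  intro X' π h
  induction h with
  | nil => intro D hD; rwa [Scheme.IdealSheafData.comap_id]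
  | cons τ σ x' hx' hσ hne hT hτ ih =>
    intro D hD
    haveI := hσ.isIntegral inferInstance
    rw [Scheme.IdealSheafData.comap_comp]
    refine hτ.comap_ne_bot ?_ (ih hD)
    intro htop
    apply hne
    have h1 : (((vanishingIdeal (⟨{x'}, hx'⟩ : Closeds _)).support : Closeds _) : Set _) = {x'} :=
      Scheme.IdealSheafData.coe_support_vanishingIdeal _
    rw [htop] at h1
    exact h1.symm

end Pullback

/-! ## The support of an effective Cartier divisor on a regular surface -/

section Support

variable {Y : Scheme.{u}}

/-- A point of the support of an effective Cartier divisor on a scheme with regular local rings has a local ring of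
positive dimension (a regular local ring of dimension `0` is a field, in which a non-zero-divisor generates the unit
ideal). [cite: StacksProject, Tag 00KV] -/
theorem ringKrullDim_stalk_ne_zero_of_mem_support (hregY : Scheme.IsRegular Y) {D : Y.IdealSheafData}
    (hD : IsEffectiveCartier D) {ζ : Y} (hζ : ζ ∈ D.support) : ringKrullDim (Y.presheaf.stalk ζ) ≠ 0 := by
  intro h0
  haveI := hregY ζ
  obtain ⟨t, ht, htspan⟩ := hD.exists_stalkIdeal_eq_span ζ
  -- dimension `0`: the maximal ideal is `⊥`, so the non-zero-divisor `t` is a unit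
  have hsf := IsRegularLocalRing.spanFinrank_maximalIdeal (R := Y.presheaf.stalk ζ)
  rw [h0] at hsf
  have hm : maximalIdeal (Y.presheaf.stalk ζ) = ⊥ :=
    (Submodule.spanFinrank_eq_zero_iff_eq_bot (IsNoetherian.noetherian _)).mp (by exact_mod_cast hsf)
  have htu : IsUnit t := by
    by_contra hu
    have : t ∈ maximalIdeal (Y.presheaf.stalk ζ) := hu
    rw [hm, Ideal.mem_bot] at this
    exact nonZeroDivisors.ne_zero ht this
  have htop : stalkIdeal D ζ = ⊤ := by rw [htspan]; exact Ideal.span_singleton_eq_top.mpr htu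
  exact absurd (htop ▸ (mem_support_iff_stalkIdeal_le D ζ).mp hζ) (fun h => IsLocalRing.maximalIdeal.isMaximal _ |>.ne_top (top_le_iff.mp h))

/-- **Decomposition of the support of an effective Cartier divisor on a regular surface into members and isolated
points**: for `Y` Noetherian with regular local rings, of dimension `≤ 2`, and `D` an effective Cartier divisor, there
are a finite set `𝒞₀` of members (`cl{η}`, `η` not closed, `dim 𝒪_{Y,η} = 1`) and a finite set `P` of closed points with
one-dimensional local rings, lying on no member, with `V(D) = ⋃ 𝒞₀ ∪ P`.
[cite: StacksProject, Tag 0BIC (Lemma 54.15.6, proof ¶2)] [cite: StacksProject, Tag 00KV] -/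
theorem exists_members_decomposition [IsNoetherian Y] (hregY : Scheme.IsRegular Y) (hY2 : topologicalKrullDim Y ≤ 2)
    {D : Y.IdealSheafData} (hD : IsEffectiveCartier D) :
    ∃ (𝒞₀ : Set (Closeds Y)) (P : Set Y), 𝒞₀.Finite ∧ P.Finite ∧
      (∀ C ∈ 𝒞₀, ∃ η : Y, (C : Set Y) = closure {η} ∧ ¬ IsClosed ({η} : Set Y) ∧
        ringKrullDim (Y.presheaf.stalk η) = 1) ∧
      (∀ p ∈ P, IsClosed ({p} : Set Y)) ∧ (∀ p ∈ P, ringKrullDim (Y.presheaf.stalk p) = 1) ∧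
      (∀ p ∈ P, ∀ C ∈ 𝒞₀, p ∉ (C : Set Y)) ∧
      (D.support : Set Y) = (⋃ C ∈ 𝒞₀, (C : Set Y)) ∪ P := by
  classical
  -- the points of the support with one-dimensional local ring are maximal points of the support
  set G : Set Y := {ζ | ζ ∈ (D.support : Set Y) ∧ ringKrullDim (Y.presheaf.stalk ζ) = 1} with hG
  have hcoh1 : ∀ {ζ : Y}, ringKrullDim (Y.presheaf.stalk ζ) = 1 → Order.coheight ζ = 1 := fun {ζ} h1 => by
    have h := ringKrullDim_stalk_eq_coheight ζ; rw [h1] at h; exact_mod_cast h.symm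
  have hGmax : G ⊆ maxPoints (D.support : Set Y) := by
    rintro ζ ⟨hζ, hζ1⟩
    refine ⟨hζ, fun ζ' hζ' hsp => ?_⟩
    by_contra hne
    -- `ζ < ζ'`: `coheight ζ' + 1 ≤ coheight ζ = 1`, so `dim 𝒪_{ζ'} = 0`
    have hlt : ζ < ζ' := by
      refine lt_iff_le_not_ge.mpr ⟨Scheme.le_iff_specializes.mpr hsp, fun h => hne ?_⟩
      exact (hsp.antisymm (Scheme.le_iff_specializes.mp h)).eq
    have h := Order.coheight_add_one_le hlt
    rw [hcoh1 hζ1] at h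
    have h0 : Order.coheight ζ' = 0 := by
      have : Order.coheight ζ' ≠ ⊤ := by intro ht; rw [ht] at h; exact absurd h (by decide)
      obtain ⟨k, hk⟩ := ENat.ne_top_iff_exists.mp this
      rw [← hk] at h ⊢
      have : k + 1 ≤ 1 := by exact_mod_cast h
      have : k = 0 := by omega
      subst this; rfl
    refine ringKrullDim_stalk_ne_zero_of_mem_support hregY hD hζ' ?_
    rw [ringKrullDim_stalk_eq_coheight ζ', h0]; rfl
  have hGfin : G.Finite := (maxPoints_finite D.support.isClosed).subset hGmax
  -- the decomposition
  refine ⟨(fun ζ : Y => (⟨closure {ζ}, isClosed_closure⟩ : Closeds Y)) '' {ζ ∈ G | ¬ IsClosed ({ζ} : Set Y)},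
    {ζ ∈ G | IsClosed ({ζ} : Set Y)}, (hGfin.subset (Set.sep_subset _ _)).image _,
    hGfin.subset (Set.sep_subset _ _), ?_, fun p hp => hp.2, fun p hp => hp.1.2, ?_, ?_⟩
  · rintro C ⟨ζ, ⟨⟨-, hζ1⟩, hζcl⟩, rfl⟩
    exact ⟨ζ, rfl, hζcl, hζ1⟩
  · rintro p ⟨⟨-, hp1⟩, hpcl⟩ C ⟨ζ, ⟨⟨-, hζ1⟩, hζcl⟩, rfl⟩ hpζ
    change p ∈ closure ({ζ} : Set Y) at hpζ
    have h2 := ringKrullDim_stalk_eq_two_of_mem_closure hY2 hζ1 hpcl hζcl hpζ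
    rw [hp1] at h2
    exact absurd h2 (by decide)
  · apply le_antisymm
    · intro x hx
      obtain ⟨ξ, hξ, hsp, hcoh⟩ := hD.exists_specializes_coheight_le_one hx
      have hξ1 : ringKrullDim (Y.presheaf.stalk ξ) = 1 := by
        have hne := ringKrullDim_stalk_ne_zero_of_mem_support hregY hD hξ
        rw [ringKrullDim_stalk_eq_coheight ξ] at hne ⊢
        have hle : Order.coheight ξ ≤ 1 := hcoh
        have : Order.coheight ξ ≠ ⊤ := by intro ht; rw [ht] at hle; exact absurd hle (by decide)
        obtain ⟨k, hk⟩ := ENat.ne_top_iff_exists.mp this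
        rw [← hk] at hle hne ⊢
        have h1 : k ≤ 1 := by exact_mod_cast hle
        have h2 : k ≠ 0 := fun h => hne (by rw [h]; rfl)
        have : k = 1 := by omega
        rw [this]; rfl
      by_cases hξcl : IsClosed ({ξ} : Set Y)
      · right
        have hx' : x ∈ closure ({ξ} : Set Y) := specializes_iff_mem_closure.mp hsp
        rw [hξcl.closure_eq, Set.mem_singleton_iff] at hx'
        rw [hx']
        exact ⟨⟨hξ, hξ1⟩, hξcl⟩
      · left
        exact Set.mem_biUnion (Set.mem_image_of_mem _ ⟨⟨hξ, hξ1⟩, hξcl⟩) (specializes_iff_mem_closure.mp hsp)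
    · apply Set.union_subset
      · rintro x hx
        rw [Set.mem_iUnion₂] at hx
        obtain ⟨C, ⟨ζ, ⟨⟨hζ, -⟩, -⟩, rfl⟩, hxC⟩ := hx
        exact closure_minimal (Set.singleton_subset_iff.mpr hζ) D.support.isClosed hxC
      · rintro p ⟨⟨hp, -⟩, -⟩
        exact hp

end Support

end F75c

end Summit.ResolutionOfSingularities.ResolutionOfSingularities.Theorems

end
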